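import Summits.AnomalousDissipation.AnomalousDissipation.Theorems.WindLineWindyGalerkinSteadyZerothLawGenericLeafNondegeneracyToolsH
import Summits.AnomalousDissipation.AnomalousDissipation.Theorems.WindLineWindyGalerkinSteadyZerothLawNormsOfH1Limit

/-!
# `WindLine.WindyGalerkinSteadyZerothLaw` (stmt-AnomalousDissipation-11414): loud steady sets are CLOSED, so the
# category, density and robust forms of the line's physics stub coincide (line `registered`, rev 7)

Support file for the crux (lands `--supports stmt-AnomalousDissipation-11414`; pure proof file, no definitions).

**Upper semicontinuity of loud steady states.**  For `ν > 0`, a momentum `m` and CLOSED budgets `E, ε`, the set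
`K(ν,m,E,ε) = {c ∈ 𝒜 | NS_ν(F⟦c⟧) has a classical steady state with ∫u = m, ∫|u|² ≤ E, ε ≤ ν‖∇u‖²}` is CLOSED in the
parameter space `𝒜 ⊆ SymL2 (Fin 3)` of entire forces (`isClosed_loudSteadyLeaf`).  Proof: along `cₙ → c₀` the state
vectors `xₙ ∈ W` of the witnesses solve `4π²ν xₙ + D xₙ + B(xₙ,xₙ) = Y cₙ` (tools C), are bounded (tools D), and by
properness (tools B) a subsequence converges IN `W` — i.e. in `H²` — to the state vector of a classical steady state
`u₀` of `NS_ν(F⟦c₀⟧)` with the same momentum (tools C); Parseval (`SteadyLattice.h1_le_of_coeff`) turns `W`-convergence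
into `H¹`-convergence `∫|u_{φn} − u₀|² + ‖∇(u_{φn} − u₀)‖² → 0`, the landed `stub_normsOfH1Limit` passes energy and
enstrophy to the limit, and closed budgets survive.

**Consequence for the line (the three physics stubs are one).**  With closed budgets the every-level loud set
`K = ⋂ⱼ K(ν_j, m_j, E, ε)` is closed, and a closed set is non-meagre iff it has non-empty interior.  Hence the
registered stub P (`stub_nonMeagreLoudSteadyForces`, category form) implies the FORCE-ROBUST form R₀ — a non-empty OPEN
set of entire forces EVERY ONE of which carries, at EVERY level, a loud bounded classical steady state of the pinned
momentum (`robustLoud_of_nonMeagreLoud`, budgets `E + 1`, `ε / 2`) — and R₀ trivially implies rev 6's density form A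
(`denseLoud_of_robustLoud`), while A ⇒ P is `nonMeagreLoud_of_denseLoud` (`…CategoryBirth.lean`).  So, up to slack in
the budgets, P ⟺ A ⟺ R₀: within this line's mechanism (pinned momenta, fixed levels, Baire over entire forces) the
physics debt is EXACTLY a ν-uniformly force-robust pinned steady zeroth law on an open set of entire forces; the
category formulation cannot be weaker than that.  This answers, with a proof, the skeptical reader's question whether
the Baire mechanism buys anything below ν-uniform robustness here: it does not.

References: Foias–Temam, CPAM 30 (1977) §1 (properness of the steady map); Saut–Temam, Indiana Univ. Math. J. 29
(1980) §2; Temam, *Navier–Stokes Equations* (1979) Ch. II §1; Oxtoby, *Measure and Category* Ch. 9.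
-/

noncomputable section

-- D-0017: single-problem summit ⇒ the duplicated namespace segment is by design.
set_option linter.dupNamespace false

open scoped BigOperators Topology ENNReal NNReal InnerProductSpace ComplexConjugate
open Filter Set Function TopologicalSpace MeasureTheory UnitAddTorus
open Literature.Analysis.FunctionSpaces Literature.Analysis.FunctionSpaces.Torus
open Literature.Analysis.FunctionSpaces.EuclideanSpace
open Literature.Analysis.FluidPDE Literature.Analysis.FluidPDE.Torus
open Literature.Analysis.FluidPDE.ScalarFourier
open Literature.Analysis.FluidPDE.SteadyLattice Literature.Analysis.FluidPDE.SteadyLatticeDrift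

namespace Summit.AnomalousDissipation.AnomalousDissipation.Theorems.WindLineWindyGalerkinSteadyZerothLaw.GenericLeaf

/-- The flat three-torus (local notation). -/
local notation "𝕋³" => UnitAddTorus (Fin 3)
/-- Velocity values (local notation). -/
local notation "E³" => EuclideanSpace ℝ (Fin 3)
/-- Complex coefficient vectors (local notation). -/
local notation "ℂ³" => EuclideanSpace ℂ (Fin 3)
/-- Square-summable coefficient families `ℤ³ → ℂ³` (local notation). -/
local notation "ℓ2" => lp (fun _ : Fin 3 → ℤ => EuclideanSpace ℂ (Fin 3)) 2
/-- Physical coefficients `x̌(k) = x(k)/|k|²` of a family (local notation, the tree's `cf`). -/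
local notation "cf[" X "]" =>
  ((fun mm : Fin 3 → ℤ => (((freqNormSq mm)⁻¹ : ℝ) : ℂ)) • (X : (Fin 3 → ℤ) → EuclideanSpace ℂ (Fin 3)))
set_option quotPrecheck false in
/-- admissible parameters -/
local notation "𝒜" => ({c : SymL2 (Fin 3) | c 0 = 0 ∧
  ∀ k : Fin 3 → ℤ, ∑ j : Fin 3, ((k j : ℤ) : ℂ) * c k j = 0} : Set (SymL2 (Fin 3)))
/-- the force of a parameter -/
local notation "F⟦" c "⟧" => SymL2.field (fun k : Fin 3 → ℤ => Real.exp (freqNormSq k)) (c : SymL2 (Fin 3))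

/-! ## §1 Loud steady sets with closed budgets are closed -/

/-- **Upper semicontinuity of loud steady states (closed budgets give a closed parameter set).**  For `ν > 0`,
`m ∈ ℝ³` and `E, ε ∈ ℝ`, the set of admissible parameters `c` whose force `F⟦c⟧` carries a classical steady state
`(u, p)` of `NS_ν` with `∫ u = m`, `∫|u|² ≤ E` and `ε ≤ ν‖∇u‖²` is closed in `𝒜`: limits of witnesses along `cₙ → c₀`
exist in `H²` by properness of the steady lattice map and keep momentum, energy bound and loudness.  [folklore;
Foias–Temam 1977 §1] -/
theorem isClosed_loudSteadyLeaf (ν : ℝ) (m : E³) (E ε : ℝ) (hν : 0 < ν) :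
    IsClosed {c : 𝒜 | ∃ (u : 𝕋³ → E³) (p : 𝕋³ → ℝ),
      IsSteadyNSState ν F⟦c⟧ u p ∧ ∫ x, u x = m ∧ ∫ x, ‖u x‖ ^ 2 ≤ E ∧ ε ≤ ν * gradNormSq u} := by
  refine IsSeqClosed.isClosed fun c c₀ hcmem hc => ?_
  have hcmem' : ∀ n, ∃ (u : 𝕋³ → E³) (p : 𝕋³ → ℝ),
      IsSteadyNSState ν F⟦c n⟧ u p ∧ ∫ x, u x = m ∧ ∫ x, ‖u x‖ ^ 2 ≤ E ∧ ε ≤ ν * gradNormSq u := fun n => hcmem n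
  choose u p hst hmean hE hε using hcmem'
  have hu : ∀ n, IsSmooth (u n) := fun n => steady_isSmooth (hst n)
  have hdiv : ∀ n, IsDivFree (u n) := fun n => steady_isDivFree (hst n)
  -- the lattice set-up
  set M : ℂ³ := complexify m with hMdef
  have hMc : conjVec M = M := conjVec_complexify m
  have hMn : ∀ n, mFourierCoeff (complexify ∘ u n) 0 = M := fun n => by
    rw [mFourierCoeff_complexify_zero (hu n), hmean n]
  obtain ⟨W, hW, hWc⟩ := exists_space
  haveI : CompleteSpace W := completeSpace_W hWc
  obtain ⟨B, hB, hBb⟩ := exists_bilinear hW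
  obtain ⟨D, hD, hDc⟩ := exists_drift hW hWc hMc
  obtain ⟨Y, hY, hYn, hYlip⟩ := exists_forceVecMap hW
  set cν : ℝ := 4 * Real.pi ^ 2 * ν with hcν
  have hcν0 : 0 < cν := by positivity
  -- state vectors and their equations
  choose x hx hcfx using fun n => exists_stateVec hW (hu n) (hdiv n)
  have heq : ∀ n, cν • x n + D (x n) + B (x n) (x n) = Y (c n) := fun n =>
    steadyMap_stateVec_eq B hB D hD (hst n) (hMn n) (x n) (hx n) (Y (c n)) (hY (c n))
  -- a priori bound
  have hcs : Tendsto (fun n => ((c n : 𝒜) : SymL2 (Fin 3))) atTop (𝓝 (c₀ : SymL2 (Fin 3))) :=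
    (continuous_subtype_val.tendsto c₀).comp hc
  obtain ⟨K, hK⟩ := (hcs.norm).bddAbove_range
  have hKn : ∀ n, ‖((c n : 𝒜) : SymL2 (Fin 3))‖ ≤ K := fun n => hK ⟨n, rfl⟩
  obtain ⟨R, hR⟩ := exists_norm_stateVec_le hW B hB D hD hν K
  have hxR : ∀ n, ‖x n‖ ≤ R := fun n => hR (c n) (hKn n) (u n) (p n) (hst n) (hMn n) (x n) (hx n)
  -- `Y cₙ → Y c₀`
  have hYc : Continuous Y := by
    refine (LipschitzWith.of_dist_le_mul (K := 1) fun a b => ?_).continuous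
    rw [NNReal.coe_one, one_mul, dist_eq_norm, Subtype.dist_eq, dist_eq_norm]
    exact hYlip a b
  have hy : Tendsto (fun n => cν • x n + D (x n) + B (x n) (x n)) atTop (𝓝 (Y c₀)) := by
    simp_rw [heq]
    exact (hYc.tendsto c₀).comp hc
  -- properness: a convergent subsequence, and the limit steady state with the same momentum
  obtain ⟨φ, z, hφ, hz, hGz⟩ := exists_tendsto_subseq_of_bounded B hB hBb D hD hWc hcν0 x hxR hy
  obtain ⟨u₀, p₀, hst₀, hu₀, hû₀⟩ := exists_steadyState_of_latticeEq hW B hB D hD hMc hν c₀ z (Y c₀) (hY c₀) hGz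
  have hu₀0 : mFourierCoeff (complexify ∘ u₀) 0 = M := by
    rw [hû₀, Pi.add_apply, cf_zero, zero_add, Pi.single_eq_same]
  have hmean₀ : ∫ y, u₀ y = m := by
    have h := hu₀0
    rw [mFourierCoeff_complexify_zero hu₀, hMdef] at h
    exact complexify_injective h
  have hcfz : cf[((z : ℓ2) : (Fin 3 → ℤ) → ℂ³)] = Function.update (mFourierCoeff (complexify ∘ u₀)) 0 0 := by
    rw [hû₀, update_add_single_of_zero (cf_zero _) M]
  -- `W`-convergence of the state vectors is `H¹`-convergence of the fields (Parseval)
  have hH : ∀ n, (∫ y, ‖u (φ n) y - u₀ y‖ ^ 2) + gradNormSq (fun y => u (φ n) y - u₀ y) ≤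
      (1 + 4 * Real.pi ^ 2) * ‖x (φ n) - z‖ ^ 2 := by
    intro n
    have hv : IsSmooth (fun y => u (φ n) y - u₀ y) := (hu (φ n)).sub hu₀
    have hcoefv : mFourierCoeff (complexify ∘ fun y => u (φ n) y - u₀ y) =
        cf[(((x (φ n) - z : W) : ℓ2) : (Fin 3 → ℤ) → ℂ³)] := by
      have e : (complexify ∘ fun y => u (φ n) y - u₀ y : 𝕋³ → ℂ³) = (complexify ∘ u (φ n)) - (complexify ∘ u₀) := by
        funext y; simp
      rw [e, coeW_sub, cf_sub, hcfx (φ n), hcfz]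
      funext k
      rw [mFourierCoeff_sub (hu (φ n)).complexify_comp.integrable hu₀.complexify_comp.integrable, Pi.sub_apply]
      by_cases hk : k = 0
      · subst hk
        rw [Function.update_self, Function.update_self, sub_zero]
        change mFourierCoeff (complexify ∘ u (φ n)) 0 - mFourierCoeff (complexify ∘ u₀) 0 = 0
        rw [hMn (φ n), hu₀0, sub_self]
      · rw [Function.update_of_ne hk, Function.update_of_ne hk]
    have h := h1_le_of_coeff hv ((x (φ n) - z : W) : ℓ2) hcoefv
    rwa [norm_coeW] at h
  have hlim : Tendsto (fun n => (∫ y, ‖u (φ n) y - u₀ y‖ ^ 2) + gradNormSq (fun y => u (φ n) y - u₀ y))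
      atTop (𝓝 0) := by
    have hz' : Tendsto (fun n => x (φ n) - z) atTop (𝓝 0) := by
      have h := hz.sub_const z
      rwa [sub_self] at h
    have hz0 : Tendsto (fun n => (1 + 4 * Real.pi ^ 2) * ‖x (φ n) - z‖ ^ 2) atTop (𝓝 0) := by
      have h := ((tendsto_norm_zero.comp hz').pow 2).const_mul (1 + 4 * Real.pi ^ 2)
      rw [zero_pow two_ne_zero, mul_zero] at h
      exact h
    exact squeeze_zero (fun n => add_nonneg (integral_nonneg fun y => by positivity) (gradNormSq_nonneg _)) hH hz0
  obtain ⟨h1, h2⟩ := stub_normsOfH1Limit u₀ (fun n => u (φ n)) hu₀ (fun n => hu (φ n)) hlim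
  refine ⟨u₀, p₀, hst₀, hmean₀, ?_, ?_⟩
  · exact le_of_tendsto' h1 fun n => hE (φ n)
  · exact ge_of_tendsto' (h2.const_mul ν) fun n => hε (φ n)

end Summit.AnomalousDissipation.AnomalousDissipation.Theorems.WindLineWindyGalerkinSteadyZerothLaw.GenericLeaf

namespace Summit.AnomalousDissipation.AnomalousDissipation.Theorems.WindLineWindyGalerkinSteadyZerothLaw

/-- The flat three-torus (local notation). -/
local notation "𝕋³" => UnitAddTorus (Fin 3)
/-- Velocity values (local notation). -/
local notation "E³" => EuclideanSpace ℝ (Fin 3)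
set_option quotPrecheck false in
/-- admissible parameters -/
local notation "𝒜" => ({c : SymL2 (Fin 3) | c 0 = 0 ∧
  ∀ k : Fin 3 → ℤ, ∑ j : Fin 3, ((k j : ℤ) : ℂ) * c k j = 0} : Set (SymL2 (Fin 3)))
/-- the force of a parameter -/
local notation "F⟦" c "⟧" => SymL2.field (fun k : Fin 3 → ℤ => Real.exp (freqNormSq k)) (c : SymL2 (Fin 3))

/-! ## §2 Category form ⇒ robust form ⇒ density form -/

/-- **P ⇒ R₀: non-meagre loud steady forces give an OPEN SET of forces, each loud at every level** (budgets
`E + 1`, `ε / 2`).  The every-level loud set with closed budgets `K = ⋂ⱼ K_j` is closed (`isClosed_loudSteadyLeaf`),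
contains P's loud set, hence is non-meagre, hence — being closed — has non-empty interior `U`
(`IsClosed.isNowhereDense_iff`, `IsNowhereDense.isMeagre`); every `c ∈ U ⊆ K` carries at every level a steady state
with `∫|u|² ≤ E < E + 1` and `ν_j‖∇u‖² ≥ ε > ε/2`.  Hypothesis inline = registered stub `stub_nonMeagreLoudSteadyForces`
of `Cruxes/WindyGalerkinSteadyZerothLaw/Lines/birth.lean` rev 7. -/
theorem robustLoud_of_nonMeagreLoud :
    (∃ (ν : ℕ → ℝ) (m : ℕ → E³) (E ε : ℝ), (∀ j, 0 < ν j) ∧ Tendsto ν atTop (𝓝 0) ∧ 0 < ε ∧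
      ¬ IsMeagre {c : 𝒜 | ∀ j, ∃ (u : 𝕋³ → E³) (p : 𝕋³ → ℝ),
          IsSteadyNSState (ν j) F⟦c⟧ u p ∧ ∫ x, u x = m j ∧
            ∫ x, ‖u x‖ ^ 2 < E ∧ ε < ν j * gradNormSq u}) →
    ∃ (ν : ℕ → ℝ) (m : ℕ → E³) (E ε : ℝ), (∀ j, 0 < ν j) ∧ Tendsto ν atTop (𝓝 0) ∧ 0 < ε ∧
      ∃ U : Set 𝒜, IsOpen U ∧ U.Nonempty ∧
        ∀ c ∈ U, ∀ j, ∃ (u : 𝕋³ → E³) (p : 𝕋³ → ℝ),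
          IsSteadyNSState (ν j) F⟦c⟧ u p ∧ ∫ x, u x = m j ∧
            ∫ x, ‖u x‖ ^ 2 < E ∧ ε < ν j * gradNormSq u := by
  rintro ⟨ν, m, E, ε, hν, hν0, hε, hL⟩
  -- the closed every-level loud set with closed budgets
  set K : Set 𝒜 := ⋂ j, {c : 𝒜 | ∃ (u : 𝕋³ → E³) (p : 𝕋³ → ℝ),
      IsSteadyNSState (ν j) F⟦c⟧ u p ∧ ∫ x, u x = m j ∧ ∫ x, ‖u x‖ ^ 2 ≤ E ∧ ε ≤ ν j * gradNormSq u} with hK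
  have hKc : IsClosed K := isClosed_iInter fun j => GenericLeaf.isClosed_loudSteadyLeaf (ν j) (m j) E ε (hν j)
  have hsub : {c : 𝒜 | ∀ j, ∃ (u : 𝕋³ → E³) (p : 𝕋³ → ℝ),
      IsSteadyNSState (ν j) F⟦c⟧ u p ∧ ∫ x, u x = m j ∧
        ∫ x, ‖u x‖ ^ 2 < E ∧ ε < ν j * gradNormSq u} ⊆ K := by
    intro c hc
    refine mem_iInter.2 fun j => ?_
    obtain ⟨u, p, hst, hm, hE, hεu⟩ := hc j
    exact ⟨u, p, hst, hm, hE.le, hεu.le⟩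
  have hKm : ¬ IsMeagre K := fun h => hL (h.mono hsub)
  -- a closed non-meagre set has non-empty interior
  have hint : (interior K).Nonempty := by
    by_contra h
    rw [not_nonempty_iff_eq_empty] at h
    exact hKm ((hKc.isNowhereDense_iff.2 h).isMeagre)
  refine ⟨ν, m, E + 1, ε / 2, hν, hν0, by positivity, interior K, isOpen_interior, hint, fun c hc j => ?_⟩
  obtain ⟨u, p, hst, hm, hE, hεu⟩ := mem_iInter.1 (interior_subset hc) j
  exact ⟨u, p, hst, hm, by linarith, by linarith⟩

/-- **R₀ ⇒ A (trivial direction): an open set of everywhere-loud forces is an open set in which loud forces are dense**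
(rev 6's `stub_denseLoudSteadyForces`, verbatim).  With `nonMeagreLoud_of_denseLoud` (A ⇒ P, `…CategoryBirth.lean`) and
`robustLoud_of_nonMeagreLoud` (P ⇒ R₀) this closes the cycle: up to slack in the budgets, the category form P, the
density form A and the robust form R₀ of the line's physics stub are EQUIVALENT. -/
theorem denseLoud_of_robustLoud
    (hR : ∃ (ν : ℕ → ℝ) (m : ℕ → E³) (E ε : ℝ), (∀ j, 0 < ν j) ∧ Tendsto ν atTop (𝓝 0) ∧ 0 < ε ∧
      ∃ U : Set 𝒜, IsOpen U ∧ U.Nonempty ∧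
        ∀ c ∈ U, ∀ j, ∃ (u : 𝕋³ → E³) (p : 𝕋³ → ℝ),
          IsSteadyNSState (ν j) F⟦c⟧ u p ∧ ∫ x, u x = m j ∧
            ∫ x, ‖u x‖ ^ 2 < E ∧ ε < ν j * gradNormSq u) :
    ∃ (ν : ℕ → ℝ) (m : ℕ → E³) (E ε : ℝ), (∀ j, 0 < ν j) ∧ Tendsto ν atTop (𝓝 0) ∧ 0 < ε ∧
      ∃ U : Set 𝒜, IsOpen U ∧ U.Nonempty ∧
        ∀ j, U ⊆ closure {c : 𝒜 | ∃ (u : 𝕋³ → E³) (p : 𝕋³ → ℝ),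
          IsSteadyNSState (ν j) F⟦c⟧ u p ∧ ∫ x, u x = m j ∧
            ∫ x, ‖u x‖ ^ 2 < E ∧ ε < ν j * gradNormSq u} := by
  obtain ⟨ν, m, E, ε, hν, hν0, hε, U, hUo, hUne, hU⟩ := hR
  exact ⟨ν, m, E, ε, hν, hν0, hε, U, hUo, hUne, fun j c hc => subset_closure (hU c hc j)⟩

/-- **P ⇒ R₀ in ONE-FORCE form: the registered stub yields a parameter `c⋆` (indeed an open set of them) whose single
force `F⟦c⋆⟧` obeys the pinned steady zeroth law at every level** — i.e. P implies the nondegeneracy-free heart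
directly, without stub B; nondegeneracy (and hence the Galerkin transfer) is the only thing B adds. -/
theorem pinnedSteadyZerothLaw_of_nonMeagreLoud
    (hP : ∃ (ν : ℕ → ℝ) (m : ℕ → E³) (E ε : ℝ), (∀ j, 0 < ν j) ∧ Tendsto ν atTop (𝓝 0) ∧ 0 < ε ∧
      ¬ IsMeagre {c : 𝒜 | ∀ j, ∃ (u : 𝕋³ → E³) (p : 𝕋³ → ℝ),
          IsSteadyNSState (ν j) F⟦c⟧ u p ∧ ∫ x, u x = m j ∧
            ∫ x, ‖u x‖ ^ 2 < E ∧ ε < ν j * gradNormSq u}) :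
    ∃ (c : 𝒜) (ν : ℕ → ℝ) (m : ℕ → E³) (E ε : ℝ), (∀ j, 0 < ν j) ∧ Tendsto ν atTop (𝓝 0) ∧ 0 < ε ∧
      ∀ j, ∃ (u : 𝕋³ → E³) (p : 𝕋³ → ℝ),
        IsSteadyNSState (ν j) F⟦c⟧ u p ∧ ∫ x, u x = m j ∧ ∫ x, ‖u x‖ ^ 2 < E ∧ ε < ν j * gradNormSq u := by
  obtain ⟨ν, m, E, ε, hν, hν0, hε, U, -, ⟨c, hc⟩, hU⟩ := robustLoud_of_nonMeagreLoud hP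
  exact ⟨c, ν, m, E, ε, hν, hν0, hε, hU c hc⟩

end Summit.AnomalousDissipation.AnomalousDissipation.Theorems.WindLineWindyGalerkinSteadyZerothLaw

end
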